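import Summits.QuantumFields.YangMills.Theorems.DiagonalMirrorRPRWilsonDiagonalModelReweight

/-!
# Crux `WeakCouplingHypercubicLimitRP` (stmt-QuantumFields-27398) / aside `DiagonalMirrorRPR` (stmt-QuantumFields-10604), door B,
# construction F1_diag — PAIRING LAYER, toolkit: marginals and independence of coordinate groups of finite product measures

Helper file (`--supports stmt-QuantumFields-27398 --as helper`) of the hand `hand-10604-wilsonDiagModel-2` (docket director-ym O4 WORD 16 (1) /
28, step P3 of hand-1's ROADMAP-F1diag v4 §1⅞); it closes nothing by itself.  GENERIC measure theory (Mathlib only), packaged in the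
shapes the pairing layer consumes:

* `measurePreserving_proj` — for an INJECTION `σ : κ → ι` of finite index types and a probability measure `ν`, the coordinate projection
  `ω ↦ (ω (σ j))_j` pushes `ν^{⊗ι}` to `ν^{⊗κ}` (marginals of a product probability measure); `integral_comp_proj`;
* `indepFun_proj` — two coordinate projections along injections with DISJOINT ranges are independent (`iIndepFun_pi` +
  `iIndepFun.indepFun_finset`); `integral_proj_mul_proj` — hence `∫ A(ω∘σ) B(ω∘τ) = (∫ A dν^{⊗κ}) (∫ B dν^{⊗κ′})`;
* `integral_pi_split` — for an equivalence `ε : κ ⊕ κ′ ≃ ι` and a σ-finite `μ`, the change of variables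
  `∫_{ι → α} F dμ^{⊗ι} = ∫_{(κ → α) × (κ′ → α)} F(join_ε p) d(μ^{⊗κ} ⊗ μ^{⊗κ′})`, `join_ε p i = Sum.elim p.1 p.2 (ε⁻¹ i)`
  (the measurable equivalence `sumPiEquivProdPi ∘ piCongrLeft`, written as an explicit lambda so that no definition is introduced);
  `integral_pi_unique` — `∫_{Unit → α} F dμ^{⊗1} = ∫ F(const) dμ`.

These are the Y-side (bond half layers, probability Haar) and V-side (lifted sites, hand-1's finite `tMeasure`) Fubini tools of the block /
free-chain factorisation of the reflected two-point insertion (files `…BlockChain`, `…BlockSandwich`).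
HONEST FRAMING: generic bookkeeping; nothing here bears on the summit; the Yang–Mills mass gap is NOT proved here or anywhere in the tree.
No definition, no instance, no notation, `autoImplicit false`.

References (for the use): K. Osterwalder, E. Seiler, Ann. Phys. 110 (1978) §2–3; B. Simon, *Functional Integration and Quantum Physics*
(1979) Ch. III (product measures of time slices). [folklore]
-/

set_option autoImplicit false

noncomputable section

open scoped BigOperators ENNReal
open MeasureTheory Function ProbabilityTheory

namespace Summit.QuantumFields.YangMills.Cruxes.DiagonalMirrorRPR.SignTwistedDiagonalTrace.WilsonDiagonal

/-! ## §1 Marginals of a product probability measure along an injection -/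

section Marginal

variable {ι κ κ' α : Type*} [Fintype ι] [Fintype κ] [Fintype κ'] [MeasurableSpace α]

omit [Fintype ι] [Fintype κ] in
/-- Coordinate projections along an index map are measurable. -/
theorem measurable_proj (σ : κ → ι) : Measurable fun ω : ι → α => fun j : κ => ω (σ j) :=
  measurable_pi_lambda _ fun j => measurable_pi_apply (σ j)

/-- **Marginals of a product probability measure**: for an injection `σ : κ → ι`, the projection `ω ↦ (ω (σ j))_j` maps `ν^{⊗ι}` to
`ν^{⊗κ}`. [folklore] -/
theorem measurePreserving_proj (ν : Measure α) [IsProbabilityMeasure ν] {σ : κ → ι} (hσ : Injective σ) :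
    MeasurePreserving (fun ω : ι → α => fun j : κ => ω (σ j)) (Measure.pi fun _ : ι => ν) (Measure.pi fun _ : κ => ν) := by
  classical
  refine ⟨measurable_proj σ, ?_⟩
  symm
  refine Measure.pi_eq fun s hs => ?_
  rw [Measure.map_apply (measurable_proj σ) (MeasurableSet.univ_pi hs)]
  -- the preimage of a box is a box
  set s' : ι → Set α := fun i => ⋂ j : κ, if σ j = i then s j else Set.univ with hs'
  have hpre : (fun ω : ι → α => fun j : κ => ω (σ j)) ⁻¹' Set.pi Set.univ s = Set.pi Set.univ s' := by
    ext ω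
    simp only [Set.mem_preimage, Set.mem_univ_pi, hs', Set.mem_iInter]
    constructor
    · intro h i j
      split_ifs with hij
      · subst hij; exact h j
      · exact Set.mem_univ _
    · intro h j
      have := h (σ j) j
      simpa using this
  have hs'm : ∀ i, MeasurableSet (s' i) := fun i =>
    MeasurableSet.iInter fun j => by
      by_cases hij : σ j = i
      · simp only [hij, if_true]; exact hs j
      · simp only [hij, if_false]; exact MeasurableSet.univ
  have hs'σ : ∀ j, s' (σ j) = s j := fun j => by
    ext a
    simp only [hs', Set.mem_iInter]
    constructor
    · intro h; simpa using h j
    · intro ha j'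
      split_ifs with hjj
      · rw [hσ hjj] ; exact ha
      · exact Set.mem_univ _
  have hs'off : ∀ i, i ∉ Finset.univ.image σ → s' i = Set.univ := fun i hi => by
    ext a
    simp only [hs', Set.mem_iInter, Set.mem_univ, iff_true]
    intro j
    have hij : σ j ≠ i := fun h => hi (Finset.mem_image.2 ⟨j, Finset.mem_univ _, h⟩)
    simp [hij]
  rw [hpre, Measure.pi_pi]
  -- `∏_i ν(s' i) = ∏_j ν(s j)`
  rw [← Finset.prod_subset (Finset.subset_univ (Finset.univ.image σ))
    (fun i _ hi => by rw [hs'off i hi, measure_univ]), Finset.prod_image fun j _ j' _ h => hσ h]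
  exact Finset.prod_congr rfl fun j _ => by rw [hs'σ]

/-- Change of variables along a marginal: `∫ A((ω (σ j))_j) dν^{⊗ι}(ω) = ∫ A dν^{⊗κ}` for an injection `σ`. [folklore] -/
theorem integral_comp_proj (ν : Measure α) [IsProbabilityMeasure ν] {σ : κ → ι} (hσ : Injective σ)
    {A : (κ → α) → ℝ} (hA : Measurable A) :
    ∫ ω, A (fun j => ω (σ j)) ∂(Measure.pi fun _ : ι => ν) = ∫ y, A y ∂(Measure.pi fun _ : κ => ν) := by
  rw [← (measurePreserving_proj ν hσ).map_eq, integral_map (measurable_proj σ).aemeasurable hA.aestronglyMeasurable]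

/-! ## §2 Independence of disjoint coordinate groups -/

/-- **Disjoint coordinate groups are independent** under a product probability measure: for index maps `σ, τ` with disjoint
ranges, `ω ↦ (ω (σ j))_j` and `ω ↦ (ω (τ j′))_{j′}` are independent. [folklore] -/
theorem indepFun_proj (ν : Measure α) [IsProbabilityMeasure ν] {σ : κ → ι} {τ : κ' → ι} (hστ : ∀ j j', σ j ≠ τ j') :
    IndepFun (fun ω : ι → α => fun j : κ => ω (σ j)) (fun ω => fun j' : κ' => ω (τ j')) (Measure.pi fun _ : ι => ν) := by
  classical
  have hind : iIndepFun (fun (i : ι) (ω : ι → α) => ω i) (Measure.pi fun _ : ι => ν) :=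
    iIndepFun_pi (X := fun _ : ι => (id : α → α)) fun _ => aemeasurable_id
  set S : Finset ι := Finset.univ.image σ with hS
  set T : Finset ι := Finset.univ.image τ with hT
  have hdisj : Disjoint S T := by
    rw [Finset.disjoint_left]
    intro i hiS hiT
    obtain ⟨j, -, rfl⟩ := Finset.mem_image.1 hiS
    obtain ⟨j', -, hj'⟩ := Finset.mem_image.1 hiT
    exact hστ j j' hj'.symm
  have h2 := hind.indepFun_finset S T hdisj fun i => measurable_pi_apply i
  have hσmem : ∀ j, σ j ∈ S := fun j => Finset.mem_image.2 ⟨j, Finset.mem_univ _, rfl⟩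
  have hτmem : ∀ j', τ j' ∈ T := fun j' => Finset.mem_image.2 ⟨j', Finset.mem_univ _, rfl⟩
  have gS : Measurable fun g : (↥S → α) => fun j : κ => g ⟨σ j, hσmem j⟩ :=
    measurable_pi_lambda _ fun j => measurable_pi_apply _
  have gT : Measurable fun g : (↥T → α) => fun j' : κ' => g ⟨τ j', hτmem j'⟩ :=
    measurable_pi_lambda _ fun j' => measurable_pi_apply _
  exact h2.comp gS gT

/-- **Product formula for disjoint coordinate groups**: `∫ A(ω∘σ) · B(ω∘τ) dν^{⊗ι} = (∫ A dν^{⊗κ}) · (∫ B dν^{⊗κ′})` for injections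
`σ, τ` with disjoint ranges and measurable `A, B`. [folklore] -/
theorem integral_proj_mul_proj (ν : Measure α) [IsProbabilityMeasure ν] {σ : κ → ι} {τ : κ' → ι}
    (hσ : Injective σ) (hτ : Injective τ) (hστ : ∀ j j', σ j ≠ τ j')
    {A : (κ → α) → ℝ} {B : (κ' → α) → ℝ} (hA : Measurable A) (hB : Measurable B) :
    ∫ ω, A (fun j => ω (σ j)) * B (fun j' => ω (τ j')) ∂(Measure.pi fun _ : ι => ν) =
      (∫ y, A y ∂(Measure.pi fun _ : κ => ν)) * ∫ y', B y' ∂(Measure.pi fun _ : κ' => ν) := by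
  rw [(indepFun_proj ν hστ).integral_fun_comp_mul_comp (measurable_proj σ).aemeasurable (measurable_proj τ).aemeasurable
    hA.aestronglyMeasurable hB.aestronglyMeasurable, integral_comp_proj ν hσ hA, integral_comp_proj ν hτ hB]

/-- Products over a coordinate group integrate to products: `∫ ∏_j g_j(ω (σ j)) dν^{⊗ι} = ∏_j ∫ g_j dν` (injective `σ`). [folklore] -/
theorem integral_prod_proj (ν : Measure α) [IsProbabilityMeasure ν] {σ : κ → ι} (hσ : Injective σ)
    {g : κ → α → ℝ} (hg : ∀ j, Measurable (g j)) :
    ∫ ω, ∏ j, g j (ω (σ j)) ∂(Measure.pi fun _ : ι => ν) = ∏ j, ∫ a, g j a ∂ν := by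
  have hA : Measurable fun y : κ → α => ∏ j, g j (y j) :=
    Finset.measurable_prod _ fun j _ => (hg j).comp (measurable_pi_apply j)
  have h := integral_comp_proj ν hσ hA
  simp only at h
  rw [h, integral_fintype_prod_eq_prod]

end Marginal

/-! ## §3 Splitting a finite product of σ-finite measures along `κ ⊕ κ′ ≃ ι` -/

section Split

variable {ι κ κ' α : Type*} [Fintype ι] [Fintype κ] [Fintype κ'] [MeasurableSpace α] (μ : Measure α) [SigmaFinite μ]

/-- **Splitting a product integral along `ε : κ ⊕ κ′ ≃ ι`**: `∫_{ι → α} F dμ^{⊗ι} = ∫ F(join_ε p) d(μ^{⊗κ} ⊗ μ^{⊗κ′})(p)` with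
`join_ε p i = Sum.elim p.1 p.2 (ε.symm i)`, for EVERY `F` (a measurable equivalence). [folklore] -/
theorem integral_pi_split (ε : κ ⊕ κ' ≃ ι) (F : (ι → α) → ℝ) :
    ∫ ω, F ω ∂(Measure.pi fun _ : ι => μ) =
      ∫ p : (κ → α) × (κ' → α), F (fun i => Sum.elim p.1 p.2 (ε.symm i))
        ∂((Measure.pi fun _ : κ => μ).prod (Measure.pi fun _ : κ' => μ)) := by
  set e : (κ → α) × (κ' → α) ≃ᵐ (ι → α) :=
    (MeasurableEquiv.sumPiEquivProdPi fun _ : κ ⊕ κ' => α).symm.trans (MeasurableEquiv.piCongrLeft (fun _ : ι => α) ε) with he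
  have hmp : MeasurePreserving e ((Measure.pi fun _ : κ => μ).prod (Measure.pi fun _ : κ' => μ)) (Measure.pi fun _ : ι => μ) := by
    have h1 := measurePreserving_sumPiEquivProdPi_symm (fun _ : κ ⊕ κ' => μ)
    have h2 := measurePreserving_piCongrLeft (fun _ : ι => μ) ε
    exact h1.trans h2
  have happly : ∀ p : (κ → α) × (κ' → α), e p = fun i => Sum.elim p.1 p.2 (ε.symm i) := by
    intro p
    funext i
    obtain ⟨s, rfl⟩ := ε.surjective i
    rw [he, MeasurableEquiv.trans_apply, MeasurableEquiv.coe_piCongrLeft, Equiv.piCongrLeft_apply_apply,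
      Equiv.symm_apply_apply]
    cases s <;> rfl
  rw [← hmp.integral_comp' (g := F)]
  simp only [happly]

omit [SigmaFinite μ] in
/-- A one-coordinate product integral is an integral: `∫_{Unit → α} F dμ^{⊗1} = ∫ F(a ↦ a) dμ`. [folklore] -/
theorem integral_pi_unique {υ : Type*} [Unique υ] (F : (υ → α) → ℝ) :
    ∫ ω, F ω ∂(Measure.pi fun _ : υ => μ) = ∫ a, F (fun _ => a) ∂μ := by
  rw [← (measurePreserving_funUnique μ υ).integral_comp' (g := fun a => F (fun _ => a))]
  refine integral_congr_ae (ae_of_all _ fun ω => ?_)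
  congr 1
  funext u
  simp [MeasurableEquiv.funUnique, Unique.eq_default u]

end Split

end Summit.QuantumFields.YangMills.Cruxes.DiagonalMirrorRPR.SignTwistedDiagonalTrace.WilsonDiagonal

end
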